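import Literature.AlgebraicGeometry.HodgeTheory.VHSDataHodgeClassesAlongPaths
import HarnessLib

/-!
# Cattani–Deligne–Kaplan over a punctured compact curve: the integral classes of type `(p,p)` with `Q(u,u) ≤ K` that FAIL to remain of type `(p,p)`
# under some continuation live over FINITELY many points (the zero-dimensional part of `S^{(K)}`); the exceptional (Noether–Lefschetz) locus of the
# curve is a countable union of finite sets, with dense complement

Topic `Literature/AlgebraicGeometry/HodgeTheory` (namespaces `Literature.AlgebraicGeometry.HodgeTheory` for the topological lemma on end lifts,
`Literature.AlgebraicGeometry.Motives.VHSData[.PunctureChart ∕ .IsLocallyFlatCharted]` for the rest), lane `lit-hodgefound` (seat `p08`, row g61-#3);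
the curve-with-ends sequel of `VHSDataHodgeClassesAlongPaths` §6 (interior charts: the points carrying a non-generic bounded class have no
accumulation point; finite on a compact base) in the style of `VHSDataNonGenericHodgeClassesFinite` (the NON-GENERIC locus — no determination of type
`(p,p)` at some point — is finite).  THEOREMS ONLY — no definition, no named fact, no instance (D-0026 net debt `0`).

PRINTED SOURCE, VERBATIM (E. Cattani, P. Deligne, A. Kaplan, *On the locus of Hodge classes*, J. AMS 8 (1995); held text `paper:arxiv-alg-geom_9402009`
p0001).  P. 483: «the locus `T ⊂ U` where `h` remains of type `(p,p)`, i.e., in `ℱ^p`, is a complex analytic subspace of `U`.»  P. 484: «Fix an integer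
`K` and let `S^{(K)}` be the space of pairs `(s,u)` with `s ∈ S`, `u ∈ 𝒱_s` integral of type `(0,0)`, and `Q(u,u) ≤ K`. It projects to `S` and arguments
as above show that, locally on `S`, `S^{(K)}` is a finite disjoint sum of closed analytic subspaces. Our main result is: **Theorem 1.1.** `S^{(K)}` is
an algebraic variety, finite over `S`. **Corollary 1.2.** Fix `s ∈ S` and `u ∈ 𝒱_s` integral of type `(0,0)`. The germ of analytic subvariety of `S`
where `u` remains of type `(0,0)`, is algebraic. *Proof*: The required algebraic subvarieties of `S` are images in `S` of irreducible components of
`S^{(K)}`, for `K = Q(u,u)`.»  P. 485, «Proof of 1.5 ⟹ 1.1»; Thm. 2.5 (p. 488); (2.4) (p. 488): «on `ℋ^r`, the pullback of the local system `𝒱_ℤ` can be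
trivialized»; 2.3 (p. 487) (the punctured-disc model of the ends).  C. Voisin, *Hodge Theory and Complex Algebraic Geometry II*, §3.3.2 (after
Thm. 3.32): «a point … lying outside a countable union of proper closed algebraic subsets»; §5.3.3.

OVER A CONNECTED CURVE `S` THIS READS: `S^{(K)}` has finitely many irreducible components, each a point or a branched cover of an open part of `S`; a
pair `(s, u)` through which a ONE-dimensional component passes has the germ of `T` equal to the germ of `S`, so `u` remains of type `(p,p)` near `s`,
hence under every continuation (`VHSDataHodgeClassesAlongPaths`, propagation); therefore **the pairs `(s, u) ∈ S^{(K)}` with a continuation NOT of type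
`(p,p)` lie on the zero-dimensional components — finitely many points of `S`**.  THIS FILE PROVES THAT SHADOW ON `S` for a locally flat-charted datum
over a punctured compact curve (§3), the ends being handled by Thm. 2.5 in the flat puncture charts (§1–§2).

CONTENT.
* §0 `HodgeTheory.exists_injOn_end_lift` — the end lifts `σ` of the punctured-disc model (`j (σ z) = φ⁻¹(e^{2πiz})`) are injective on balls of radius
  `≤ 1/2` inside `{Im z > A₀}` (`e^{2πiz₁} = e^{2πiz₂}` forces `z₁ − z₂ ∈ ℤ`).
* §1 **`PunctureChart.IsFlat.exists_forall_isHodgeAt_transport_comp`** — Thm. 2.5 ∕ 1.5 in a FLAT puncture chart with the continuation made explicit: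
  beyond some height, for `u ∈ V_ℤ,σ(z)` of type `(p,p)` with `Q(u,u) ≤ K`, the continuation of `u` along `σ ∘ γ̃`, for EVERY path `γ̃` of the closed
  half-plane `{Im ≥ A₀}` ending beyond the height, is of type `(p,p)` (`1 ⊗ e_z(u) ∈ Φ^p(z′)` read through the flat frame).
* §2 **`PunctureChart.IsFlat.exists_forall_isHodgeAlong_univ`** — THE END ARGUMENT: if moreover flat interior charts cover `S`, `σ` is continuous on an
  open half-plane `{Im > A}` and locally injective there, then beyond some height EVERY integral class of type `(p,p)` with `Q(u,u) ≤ K` at `σ(z)`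
  remains of type `(p,p)` under EVERY continuation along every path of `S`: in the flat interior chart at `σ(z)` the in-disc locus of `u` contains the
  points `σ(z′)`, `z′` near `z` (§1 along the segments, which stay in the chart domain), which accumulate at `σ(z)` by local injectivity — so by the germ
  dichotomy `u` remains of type `(p,p)` on the disc, and by propagation everywhere.
* §3 **`IsLocallyFlatCharted.finite_setOf_exceptional_le`** — over a base with flat interior charts covering `S`, flat puncture charts along ends
  `σ i` that are continuous and locally injective on open half-planes `{Im > A i}`, and a compact core off the ends beyond any prescribed heights, **the
  set of points carrying an integral class `u` of type `(p,p)` with `Q(u,u) ≤ K` and a continuation that is NOT of type `(p,p)` is FINITE** (no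
  accumulation point by `VHSDataHodgeClassesAlongPaths` §6, off the ends beyond suitable heights by §2, closed, inside the compact core);
  **`…_of_compactification`** (punctured compact curve: core, continuity and local injectivity of the end lifts read off a compactification `j : S ↪ X`
  with disc charts at the punctures); hence **`exceptionalHodgeLocus_eq_iUnion_finite[_of_compactification]`** (the exceptional locus of the curve is
  a countable union of FINITE sets), `countable_exceptionalHodgeLocus_of_ends` (no Lindelöf hypothesis) and `dense_compl_exceptionalHodgeLocus_of_ends`;
  `nonGenericHodgeLocus_subset_setOf_exceptional_le` (path-connected base: the non-generic locus of `VHSDataNonGenericHodgeClassesFinite` lies inside).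

HONEST SCOPE.  `dim S = 1`; flat interior and puncture charts are HYPOTHESES (for an honest polarized `ℤ`VHS over a curve with unipotent local
monodromies they exist — nilpotent orbit theorem, triviality of local systems on discs and half-planes — cited, not constructed); the analytic-space
structure of `S^{(K)}` and its components are not formalized, only the trace on `S` described above; connectedness of `S` is NOT needed for §3.

## References

* [CattaniDeligneKaplan1995] E. Cattani, P. Deligne, A. Kaplan, *On the locus of Hodge classes*, J. Amer. Math. Soc. 8 (1995) 483–506: §1 (p. 483),
  Thm. 1.1, Cor. 1.2 (p. 484), Thm. 1.5 and «Proof of 1.5 ⟹ 1.1» (p. 485), 2.3 (p. 487), (2.4), Thm. 2.5 (p. 488), 2.12 (p. 491).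
* [VoisinHodgeII2003] C. Voisin, *Hodge Theory and Complex Algebraic Geometry II*, CUP (2003), §3.3.2 (remark after Thm. 3.32), §5.3.1 Lemma 5.13, §5.3.3.
* [Schmid1973] W. Schmid, *Variation of Hodge structure: the singularities of the period mapping*, Invent. Math. 22 (1973), §2, (4.9)–(4.12) (cite only).
* [FritzscheGrauert2002] K. Fritzsche, H. Grauert, *From Holomorphic Functions to Complex Manifolds*, GTM 213 (2002), Ch. I §8 (identity principle, `n = 1`).
-/

noncomputable section

open scoped TensorProduct ComplexOrder
open _root_.Topology _root_.Filter Set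

universe u

namespace Literature.AlgebraicGeometry

open Motives Motives.HodgeStructure HodgeTheory Topology
open Motives.HodgeStructure (conj ofRat ofRat_apply conj_ofRat)

/-! ## §0 The end lifts of the punctured-disc model are locally injective -/

namespace HodgeTheory

variable {S : Type*} {X : Type*} [TopologicalSpace X]

/-- **The end lift `σ` of the punctured-disc model is injective on every ball of radius `≤ 1/2` inside `{Im z > A₀}`**: if `j (σ z) = φ⁻¹(e^{2πiz})`
there (disc of radius `e^{−2πA₀}` inside the chart target), then `σ z₁ = σ z₂` gives `e^{2πiz₁} = e^{2πiz₂}`, i.e. `z₁ − z₂ ∈ ℤ`, and `|z₁ − z₂| < 1`.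
[cite: CattaniDeligneKaplan1995, 2.3 (p. 487)] -/
theorem exists_injOn_end_lift {j : S → X} (φ : OpenPartialHomeomorph X ℂ) {A₀ : ℝ}
    (hball : Metric.ball (0 : ℂ) (Real.exp (-(2 * Real.pi * A₀))) ⊆ φ.target) {σ : ℂ → S}
    (hσ : ∀ z : ℂ, A₀ < z.im → j (σ z) = φ.symm (Complex.exp (2 * Real.pi * Complex.I * z))) {z : ℂ} (hz : A₀ < z.im) :
    ∃ ρ > 0, Set.InjOn σ (Metric.ball z ρ) := by
  refine ⟨min (z.im - A₀) (1 / 2), lt_min (sub_pos.2 hz) one_half_pos, fun z₁ hz₁ z₂ hz₂ heq => ?_⟩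
  have him : ∀ w ∈ Metric.ball z (min (z.im - A₀) (1 / 2)), A₀ < w.im := fun w hw => by
    have h1 : |(w - z).im| ≤ ‖w - z‖ := Complex.abs_im_le_norm (w - z)
    have h2 : ‖w - z‖ < z.im - A₀ := (mem_ball_iff_norm.1 hw).trans_le (min_le_left _ _)
    rw [Complex.sub_im] at h1
    linarith [(abs_lt.1 (h1.trans_lt h2)).1]
  have he : Complex.exp (2 * Real.pi * Complex.I * z₁) = Complex.exp (2 * Real.pi * Complex.I * z₂) := by
    rw [← (Literature.Topology.chart_apply_end_lift φ hball hσ (him z₁ hz₁)).2,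
      ← (Literature.Topology.chart_apply_end_lift φ hball hσ (him z₂ hz₂)).2, heq]
  obtain ⟨n, hn⟩ := Complex.exp_eq_exp_iff_exists_int.1 he
  have h2pi : (2 * Real.pi * Complex.I : ℂ) ≠ 0 := by simp [Real.pi_ne_zero, Complex.I_ne_zero]
  have hz12 : z₁ = z₂ + n := by
    have h : (2 * Real.pi * Complex.I) * z₁ = (2 * Real.pi * Complex.I) * (z₂ + n) := by
      rw [hn]
      ring
    exact mul_left_cancel₀ h2pi h
  have hlt : ‖z₁ - z₂‖ < 1 :=
    calc ‖z₁ - z₂‖ ≤ ‖z₁ - z‖ + ‖z - z₂‖ := norm_sub_le_norm_sub_add_norm_sub _ _ _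
      _ < 1 / 2 + 1 / 2 := add_lt_add ((mem_ball_iff_norm.1 hz₁).trans_le (min_le_right _ _))
          (by rw [norm_sub_rev]; exact (mem_ball_iff_norm.1 hz₂).trans_le (min_le_right _ _))
      _ = 1 := by norm_num
  rw [hz12, add_sub_cancel_left, Complex.norm_intCast] at hlt
  have hn0 : n = 0 := Int.abs_lt_one_iff.1 (by exact_mod_cast hlt)
  rw [hz12, hn0, Int.cast_zero, add_zero]

/-- The family form for the end lifts `σ i` of a punctured compact curve. [cite: CattaniDeligneKaplan1995, 2.3 (p. 487)] -/
theorem exists_injOn_end_lifts {ι : Type*} {j : S → X} (φ : ι → OpenPartialHomeomorph X ℂ) (A₀ : ι → ℝ)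
    (hball : ∀ i, Metric.ball (0 : ℂ) (Real.exp (-(2 * Real.pi * A₀ i))) ⊆ (φ i).target) (σ : ι → ℂ → S)
    (hσ : ∀ (i : ι) (z : ℂ), A₀ i < z.im → j (σ i z) = (φ i).symm (Complex.exp (2 * Real.pi * Complex.I * z))) (i : ι) (z : ℂ)
    (hz : A₀ i < z.im) : ∃ ρ > 0, Set.InjOn (σ i) (Metric.ball z ρ) :=
  exists_injOn_end_lift (φ i) (hball i) (hσ i) hz

/-- On a base covered by charts into `ℂ`, a countable set has dense complement (its trace on a chart domain is carried onto a countable subset of `ℂ`,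
which contains no nonempty open set). [cite: FritzscheGrauert2002, Ch. I §8] -/
private theorem dense_compl_of_countable' {S : Type*} [TopologicalSpace S] {α : Type*} (ψ : α → OpenPartialHomeomorph S ℂ)
    (hcov : ∀ x : S, ∃ a, x ∈ (ψ a).source) {Z : Set S} (hZ : Z.Countable) : Dense Zᶜ := by
  rw [← interior_eq_empty_iff_dense_compl]
  by_contra hne
  obtain ⟨x, hx⟩ := nonempty_iff_ne_empty.2 hne
  obtain ⟨a, hxa⟩ := hcov x
  have hO : IsOpen (interior Z ∩ (ψ a).source) := isOpen_interior.inter (ψ a).open_source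
  have hO' : IsOpen (ψ a '' (interior Z ∩ (ψ a).source)) := (ψ a).isOpen_image_of_subset_source hO inter_subset_right
  have hcount : (ψ a '' (Z ∩ (ψ a).source)).Countable := (hZ.mono inter_subset_left).image _
  obtain ⟨c, ⟨y, hy, rfl⟩, hcZ⟩ := (hcount.dense_compl ℂ).inter_open_nonempty _ hO' ⟨ψ a x, x, ⟨hx, hxa⟩, rfl⟩
  exact hcZ ⟨y, ⟨interior_subset hy.1, hy.2⟩, rfl⟩

end HodgeTheory

namespace Motives.VHSData

variable {S : Type} [TopologicalSpace S] {k : ℤ} {D : VHSData S k}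
variable {V : Type u} [AddCommGroup V] [Module ℚ V] [FiniteDimensional ℚ V]

/-! ## §1 Thm. 2.5 in a flat puncture chart, with the continuation made explicit -/

namespace PunctureChart

variable {σ : ℂ → S} {L : PolarizedLimitMixedHodgeStructure V k} {C : D.PunctureChart σ L} {p : ℤ}

/-- **BEYOND SOME HEIGHT OF A FLAT PUNCTURE CHART, EVERY BOUNDED HODGE CLASS REMAINS OF TYPE `(p,p)` ALONG THE LIFTED PATHS**: there is `A₁ ≥ A₀` such
that for `Im z ≥ A₁`, `u ∈ V_ℤ,σ(z)` of type `(p,p)` with `Q(u,u) ≤ K`, `Im z′ ≥ A₁`, and EVERY path `γ̃` from `z` to `z′` inside the closed half-plane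
`{Im ≥ A₀}`, the continuation of `u` along `σ ∘ γ̃` is of type `(p,p)` at `σ(z′)` (Thm. 2.5 ∕ 1.5 in the chart: `1 ⊗ e_z(u) ∈ Φ^p(z′)`; the flat frame
reads the continuation as `e_{z′}((σ ∘ γ̃) · u) = e_z(u)`). [cite: CattaniDeligneKaplan1995, Thm. 1.5 (p. 485), (2.4) and Thm. 2.5 (p. 488), 2.12 (p. 491)]
[cite: Schmid1973, §2 (cite only)] -/
theorem IsFlat.exists_forall_isHodgeAt_transport_comp (hC : C.IsFlat) (hpk : p + p = k) (K : ℤ) :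
    ∃ A₁ : ℝ, C.A₀ ≤ A₁ ∧ ∀ z : ℂ, A₁ ≤ z.im → ∀ u : D.VZ.fiber (σ z), D.IsHodgeAt (σ z) p u →
      (D.form (σ z)).form (D.toRat (σ z) u) (D.toRat (σ z) u) ≤ (K : ℚ) → ∀ z' : ℂ, A₁ ≤ z'.im →
      ∀ (γ' : Path z z') (γ : Path (σ z) (σ z')), (∀ t, C.A₀ ≤ (γ' t).im) → (∀ t, γ t = σ (γ' t)) →
        D.IsHodgeAt (σ z') p (D.VZ.transport (Path.Homotopic.Quotient.mk γ) u) := by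
  obtain ⟨A₁, -, hA₁, hmem, -⟩ := C.exists_threshold_isHodgeAt hpk K
  refine ⟨A₁, hA₁, fun z hz u hu hK z' hz' γ' γ hγ' hγ => ?_⟩
  obtain ⟨-, hall⟩ := hmem z hz u hK hu
  rw [D.isHodgeAt_iff_ofRat_mem_of_map_F_eq (C.e z') (C.map_F_eq z' (hA₁.trans hz') p), ← D.transport_toRat, hC γ' γ hγ' hγ]
  exact hall z' hz'

/-! ## §2 The end argument: beyond some height every bounded Hodge class is generic -/

/-- **BEYOND SOME HEIGHT OF A FLAT PUNCTURE CHART, EVERY INTEGRAL CLASS OF TYPE `(p,p)` WITH `Q(u,u) ≤ K` REMAINS OF TYPE `(p,p)` UNDER EVERY CONTINUATION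
ALONG EVERY PATH OF `S`.**  Hypotheses: flat interior charts cover `S` (germ dichotomy and propagation, `VHSDataHodgeClassesAlongPaths`); the end map `σ` is
continuous and locally injective on an open half-plane `{Im > A}`.  Proof: at `σ(z)` take a flat interior chart; for `z′` in a small ball around `z` the
path `σ ∘ [z, z′]` stays in the chart domain and, by §1, continues `u` to a class of type `(p,p)` at `σ(z′)`; these points accumulate at `σ(z)` (local
injectivity), so by the germ dichotomy `u` remains of type `(p,p)` on the whole disc, hence — by propagation — under every continuation.
[cite: CattaniDeligneKaplan1995, §1 (p. 483), Cor. 1.2 (p. 484), Thm. 2.5 (p. 488)] [cite: FritzscheGrauert2002, Ch. I §8 (after Prop. 8.1, n = 1)] -/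
theorem IsFlat.exists_forall_isHodgeAlong_univ
    (hchart : ∀ x : S, ∃ (φ : OpenPartialHomeomorph S ℂ) (V' : Type) (_ : AddCommGroup V') (_ : Module ℚ V') (_ : FiniteDimensional ℚ V')
      (H₀ : HodgeStructure V' k) (P₀ : H₀.Polarization) (C' : D.InteriorChart φ P₀), x ∈ φ.source ∧ C'.IsFlat)
    (hC : C.IsFlat) (hpk : p + p = k) (K : ℤ) {A : ℝ} (hσ : ContinuousOn σ {w : ℂ | A < w.im})
    (hinj : ∀ z : ℂ, A < z.im → ∃ ρ > 0, Set.InjOn σ (Metric.ball z ρ)) :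
    ∃ A₁ : ℝ, C.A₀ ≤ A₁ ∧ A ≤ A₁ ∧ ∀ z : ℂ, A₁ < z.im → ∀ u : D.VZ.fiber (σ z), D.IsHodgeAt (σ z) p u →
      (D.form (σ z)).form (D.toRat (σ z) u) (D.toRat (σ z) u) ≤ (K : ℚ) → D.IsHodgeAlong p u univ := by
  obtain ⟨A₁, hA₁, hprop⟩ := hC.exists_forall_isHodgeAt_transport_comp hpk K
  refine ⟨max A₁ A, hA₁.trans (le_max_left _ _), le_max_right _ _, fun z hz u hu hK => ?_⟩
  have hzA : A < z.im := (le_max_right _ _).trans_lt hz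
  have hzA₁ : A₁ ≤ z.im := ((le_max_left _ _).trans_lt hz).le
  obtain ⟨φ, V', _, _, _, H₀, P₀, C', hx, hC'⟩ := hchart (σ z)
  rcases hC'.isHodgeAlong_source_or_forall_eventually' hx u with hsrc | hiso
  · exact isHodgeAlong_univ_of_mem_nhds_of_charts hchart (φ.open_source.mem_nhds hx) hsrc
  · exfalso
    -- a ball around `z` above the heights, inside `σ⁻¹(chart domain)`, on which `σ` is injective
    have hopen : IsOpen {w : ℂ | max A₁ A < w.im} := isOpen_lt continuous_const Complex.continuous_im
    have hσz : ContinuousAt σ z := hσ.continuousAt ((isOpen_lt continuous_const Complex.continuous_im).mem_nhds hzA)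
    obtain ⟨ρ₀, hρ₀, hinj₀⟩ := hinj z hzA
    have hn : σ ⁻¹' φ.source ∩ {w : ℂ | max A₁ A < w.im} ∩ Metric.ball z ρ₀ ∈ 𝓝 z :=
      inter_mem (inter_mem (hσz.preimage_mem_nhds (φ.open_source.mem_nhds hx)) (hopen.mem_nhds hz)) (Metric.ball_mem_nhds z hρ₀)
    obtain ⟨ρ, hρ, hball⟩ := Metric.mem_nhds_iff.1 hn
    -- every point of the ball is reached by an in-domain lifted path along which `u` stays of type `(p,p)` (§1)
    have P : ∀ z' ∈ Metric.ball z ρ, ∃ γ : Path (σ z) (σ z'), (∀ τ, γ τ ∈ φ.source) ∧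
        D.IsHodgeAt (σ z') p (D.VZ.transport (Path.Homotopic.Quotient.mk γ) u) := fun z' hz' => by
      obtain ⟨γ', hγ'⟩ := ((convex_ball z ρ).isPathConnected ⟨z, Metric.mem_ball_self hρ⟩).joinedIn z (Metric.mem_ball_self hρ) z' hz'
      have hcont : Continuous fun t => σ (γ' t) :=
        hσ.comp_continuous γ'.continuous fun t => (le_max_right A₁ A).trans_lt (hball (hγ' t)).1.2
      let γ : Path (σ z) (σ z') := ⟨⟨fun t => σ (γ' t), hcont⟩, by simp, by simp⟩
      refine ⟨γ, fun τ => (hball (hγ' τ)).1.1, ?_⟩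
      exact hprop z hzA₁ u hu hK z' ((le_max_left A₁ A).trans (hball hz').1.2.le) γ' γ
        (fun t => hA₁.trans ((le_max_left A₁ A).trans (hball (hγ' t)).1.2.le)) fun _ => rfl
    -- `σ` maps punctured neighbourhoods of `z` into punctured neighbourhoods of `σ z` (continuity and local injectivity)
    have htends : Tendsto σ (𝓝[≠] z) (𝓝[≠] (σ z)) := by
      refine tendsto_nhdsWithin_iff.2 ⟨hσz.tendsto.mono_left nhdsWithin_le_nhds, ?_⟩
      filter_upwards [mem_nhdsWithin_of_mem_nhds (Metric.ball_mem_nhds z hρ₀), self_mem_nhdsWithin] with z' hz' hne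
      exact fun heq => hne (hinj₀ hz' (Metric.mem_ball_self hρ₀) heq)
    have h1 := htends.eventually (hiso (σ z) hx)
    have h2 : ∀ᶠ z' in 𝓝[≠] z, z' ∈ Metric.ball z ρ := mem_nhdsWithin_of_mem_nhds (Metric.ball_mem_nhds z hρ)
    obtain ⟨z', hQ, hz'⟩ := (h1.and h2).exists
    obtain ⟨γ, hγ, hH⟩ := P z' hz'
    exact hQ γ hγ hH

end PunctureChart

/-! ## §3 Over a curve with ends: the bounded non-generic classes live over finitely many points -/

namespace IsLocallyFlatCharted

variable {α ι : Type*} {ψ : α → OpenPartialHomeomorph S ℂ} {σ : ι → ℂ → S} {p : ℤ}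

omit [FiniteDimensional ℚ V] in
/-- **CATTANI–DELIGNE–KAPLAN OVER A CURVE WITH ENDS: THE POINTS CARRYING A NON-GENERIC CLASS OF TYPE `(p,p)` WITH `Q(u,u) ≤ K` ARE FINITELY MANY.**
`D : VHSData S k` locally flat-charted by discs `ψ a` covering `S` and ends `σ i` (flat puncture charts), the end maps continuous and locally injective on
the open half-planes `{Im > A i}`, and a compact core off the ends beyond any prescribed heights `≥ A i`; `p + p = k`; `K : ℤ`.  Then **the set of points
`s` carrying an integral class `u` of type `(p,p)` with `Q(u,u) ≤ K` having a continuation along some path of `S` that is NOT of type `(p,p)` is FINITE**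
(the pairs `(s, u)` on the zero-dimensional components of `S^{(K)}`).  Proof: no accumulation point (interior charts,
`eventually_not_mem_setOf_exceptional_le`), empty beyond suitable heights on each end (§2), closed, inside the compact core.
[cite: CattaniDeligneKaplan1995, §1 (pp. 483–484), Thm. 1.1, Cor. 1.2, Thm. 1.5 and «Proof of 1.5 ⟹ 1.1» (p. 485), Thm. 2.5 (p. 488)]
[cite: FritzscheGrauert2002, Ch. I §8 (after Prop. 8.1, n = 1)] [cite: Schmid1973, §2 (cite only)] -/
theorem finite_setOf_exceptional_le (h : D.IsLocallyFlatCharted ψ σ) (hpk : p + p = k) (K : ℤ) (hcov : ∀ x : S, ∃ a, x ∈ (ψ a).source)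
    (A : ι → ℝ) (hcore : ∀ A' : ι → ℝ, (∀ i, A i ≤ A' i) → ∃ K₀ : Set S, IsCompact K₀ ∧ K₀ ∪ ⋃ i, σ i '' {z : ℂ | A' i < z.im} = univ)
    (hcont : ∀ i, ContinuousOn (σ i) {z : ℂ | A i < z.im}) (hinj : ∀ (i : ι) (z : ℂ), A i < z.im → ∃ ρ > 0, Set.InjOn (σ i) (Metric.ball z ρ)) :
    {s : S | ∃ u : D.VZ.fiber s, D.IsHodgeAt s p u ∧ (D.form s).form (D.toRat s u) (D.toRat s u) ≤ (K : ℚ) ∧ ¬ D.IsHodgeAlong p u univ}.Finite := by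
  set E : Set S := {s : S | ∃ u : D.VZ.fiber s, D.IsHodgeAt s p u ∧ (D.form s).form (D.toRat s u) (D.toRat s u) ≤ (K : ℚ) ∧
    ¬ D.IsHodgeAlong p u univ} with hE
  -- (A) no accumulation point
  have hA : ∀ x : S, ∀ᶠ y in 𝓝[≠] x, y ∉ E := h.eventually_not_mem_setOf_exceptional_le hpk K hcov
  -- (B) beyond some height, the ends avoid `E`
  have hB : ∀ i, ∃ A₁ : ℝ, A i ≤ A₁ ∧ ∀ z : ℂ, A₁ < z.im → σ i z ∉ E := fun i => by
    obtain ⟨W, _, _, _, L, C, hC⟩ := h.puncture i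
    obtain ⟨A₁, -, hA₁, hgen⟩ := hC.exists_forall_isHodgeAlong_univ (h.exists_isFlat_interiorChart hcov) hpk K (hcont i) (hinj i)
    refine ⟨A₁, hA₁, fun z hz => ?_⟩
    rintro ⟨u, hu, hK, hnot⟩
    exact hnot (hgen z hz u hu hK)
  choose A' hA' hE' using hB
  obtain ⟨K₀, hK₀, hcovK⟩ := hcore A' hA'
  -- (C) closed, inside the compact core, without accumulation point: finite
  have hsub : E ⊆ K₀ := fun s hs => by
    have hs' : s ∈ K₀ ∪ ⋃ i, σ i '' {z : ℂ | A' i < z.im} := by rw [hcovK]; exact mem_univ s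
    rcases hs' with hs' | hs'
    · exact hs'
    · obtain ⟨i, z, hz, rfl⟩ := mem_iUnion.1 hs'
      exact absurd hs (hE' i z hz)
  exact Set.Finite.of_isClosed_of_subset_isCompact_of_forall_eventually_not_mem (h.isClosed_setOf_exceptional_le hpk K hcov) hK₀ hsub
    fun x _ => hA x

variable {X : Type*} [TopologicalSpace X] [CompactSpace X]

omit [FiniteDimensional ℚ V] in
/-- **THE SAME OVER A PUNCTURED COMPACT CURVE**: the compact core, the continuity and the local injectivity of the end maps read off a compactification
`j : S ↪ X` (`X` compact, `X ∖ j(S) ⊆ {pt i}`, disc charts `φ i` centred at the punctures whose targets contain the discs of radius `e^{−2πA i}`,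
`j (σ i z) = (φ i)⁻¹(e^{2πiz})` beyond height `A i`). [cite: CattaniDeligneKaplan1995, Thm. 1.1, Cor. 1.2 (p. 484), «Proof of 1.5 ⟹ 1.1» (p. 485), 2.3 (p. 487)] -/
theorem finite_setOf_exceptional_le_of_compactification (h : D.IsLocallyFlatCharted ψ σ) (hpk : p + p = k) (K : ℤ)
    (hcov : ∀ x : S, ∃ a, x ∈ (ψ a).source) (A : ι → ℝ)
    {j : S → X} (hj : IsEmbedding j) (pt : ι → X) (hpS : ∀ i, pt i ∉ range j) (hcovX : ∀ x : X, x ∉ range j → ∃ i, x = pt i)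
    (φ : ι → OpenPartialHomeomorph X ℂ) (hp : ∀ i, pt i ∈ (φ i).source) (hφp : ∀ i, φ i (pt i) = 0)
    (hball : ∀ i, Metric.ball (0 : ℂ) (Real.exp (-(2 * Real.pi * A i))) ⊆ (φ i).target)
    (hσ : ∀ (i : ι) (z : ℂ), A i < z.im → j (σ i z) = (φ i).symm (Complex.exp (2 * Real.pi * Complex.I * z))) :
    {s : S | ∃ u : D.VZ.fiber s, D.IsHodgeAt s p u ∧ (D.form s).form (D.toRat s u) (D.toRat s u) ≤ (K : ℚ) ∧ ¬ D.IsHodgeAlong p u univ}.Finite :=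
  h.finite_setOf_exceptional_le hpk K hcov A (Topology.exists_isCompact_core hj pt hpS hcovX φ hp hφp A hball σ hσ)
    (continuousOn_end_lifts hj φ A hball σ hσ) (exists_injOn_end_lifts φ A hball σ hσ)

omit [FiniteDimensional ℚ V] in
/-- **THE EXCEPTIONAL HODGE LOCUS OF A CURVE WITH ENDS IS A COUNTABLE UNION OF FINITE SETS** (one for each norm bound `K`: the images of the
zero-dimensional components of the `S^{(K)}`). [cite: CattaniDeligneKaplan1995, Thm. 1.1, Cor. 1.2 (p. 484)] [cite: VoisinHodgeII2003, §3.3.2 (remark after Thm. 3.32) and §5.3.3] -/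
theorem exceptionalHodgeLocus_eq_iUnion_finite (h : D.IsLocallyFlatCharted ψ σ) (hpk : p + p = k) (hcov : ∀ x : S, ∃ a, x ∈ (ψ a).source)
    (A : ι → ℝ) (hcore : ∀ A' : ι → ℝ, (∀ i, A i ≤ A' i) → ∃ K₀ : Set S, IsCompact K₀ ∧ K₀ ∪ ⋃ i, σ i '' {z : ℂ | A' i < z.im} = univ)
    (hcont : ∀ i, ContinuousOn (σ i) {z : ℂ | A i < z.im}) (hinj : ∀ (i : ι) (z : ℂ), A i < z.im → ∃ ρ > 0, Set.InjOn (σ i) (Metric.ball z ρ)) :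
    ∃ E : ℤ → Set S, (∀ K, (E K).Finite) ∧ D.exceptionalHodgeLocus p = ⋃ K, E K :=
  ⟨_, fun K => h.finite_setOf_exceptional_le hpk K hcov A hcore hcont hinj, exceptionalHodgeLocus_eq_iUnion p⟩

omit [FiniteDimensional ℚ V] in
/-- The same over a punctured compact curve. [cite: CattaniDeligneKaplan1995, Thm. 1.1, Cor. 1.2 (p. 484), 2.3 (p. 487)] [cite: VoisinHodgeII2003, §3.3.2 and §5.3.3] -/
theorem exceptionalHodgeLocus_eq_iUnion_finite_of_compactification (h : D.IsLocallyFlatCharted ψ σ) (hpk : p + p = k)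
    (hcov : ∀ x : S, ∃ a, x ∈ (ψ a).source) (A : ι → ℝ)
    {j : S → X} (hj : IsEmbedding j) (pt : ι → X) (hpS : ∀ i, pt i ∉ range j) (hcovX : ∀ x : X, x ∉ range j → ∃ i, x = pt i)
    (φ : ι → OpenPartialHomeomorph X ℂ) (hp : ∀ i, pt i ∈ (φ i).source) (hφp : ∀ i, φ i (pt i) = 0)
    (hball : ∀ i, Metric.ball (0 : ℂ) (Real.exp (-(2 * Real.pi * A i))) ⊆ (φ i).target)
    (hσ : ∀ (i : ι) (z : ℂ), A i < z.im → j (σ i z) = (φ i).symm (Complex.exp (2 * Real.pi * Complex.I * z))) :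
    ∃ E : ℤ → Set S, (∀ K, (E K).Finite) ∧ D.exceptionalHodgeLocus p = ⋃ K, E K :=
  ⟨_, fun K => h.finite_setOf_exceptional_le_of_compactification hpk K hcov A hj pt hpS hcovX φ hp hφp hball hσ, exceptionalHodgeLocus_eq_iUnion p⟩

omit [FiniteDimensional ℚ V] in
/-- **The exceptional Hodge locus of a curve with ends is COUNTABLE** (no Lindelöf hypothesis on the base: the compact core and the ends do the work).
[cite: CattaniDeligneKaplan1995, Thm. 1.1, Cor. 1.2 (p. 484)] [cite: VoisinHodgeII2003, §3.3.2 (remark after Thm. 3.32)] -/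
theorem countable_exceptionalHodgeLocus_of_ends (h : D.IsLocallyFlatCharted ψ σ) (hpk : p + p = k) (hcov : ∀ x : S, ∃ a, x ∈ (ψ a).source)
    (A : ι → ℝ) (hcore : ∀ A' : ι → ℝ, (∀ i, A i ≤ A' i) → ∃ K₀ : Set S, IsCompact K₀ ∧ K₀ ∪ ⋃ i, σ i '' {z : ℂ | A' i < z.im} = univ)
    (hcont : ∀ i, ContinuousOn (σ i) {z : ℂ | A i < z.im}) (hinj : ∀ (i : ι) (z : ℂ), A i < z.im → ∃ ρ > 0, Set.InjOn (σ i) (Metric.ball z ρ)) :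
    (D.exceptionalHodgeLocus p).Countable := by
  obtain ⟨E, hE, heq⟩ := h.exceptionalHodgeLocus_eq_iUnion_finite hpk hcov A hcore hcont hinj
  rw [heq]
  exact countable_iUnion fun K => (hE K).countable

omit [FiniteDimensional ℚ V] in
/-- **… and its complement is DENSE** (the very general point of the curve carries only generic integral classes of type `(p,p)`).
[cite: VoisinHodgeII2003, §3.3.2 (remark after Thm. 3.32) and §5.3.3] [cite: CattaniDeligneKaplan1995, Cor. 1.2 (p. 484)] -/
theorem dense_compl_exceptionalHodgeLocus_of_ends (h : D.IsLocallyFlatCharted ψ σ) (hpk : p + p = k) (hcov : ∀ x : S, ∃ a, x ∈ (ψ a).source)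
    (A : ι → ℝ) (hcore : ∀ A' : ι → ℝ, (∀ i, A i ≤ A' i) → ∃ K₀ : Set S, IsCompact K₀ ∧ K₀ ∪ ⋃ i, σ i '' {z : ℂ | A' i < z.im} = univ)
    (hcont : ∀ i, ContinuousOn (σ i) {z : ℂ | A i < z.im}) (hinj : ∀ (i : ι) (z : ℂ), A i < z.im → ∃ ρ > 0, Set.InjOn (σ i) (Metric.ball z ρ)) :
    Dense (D.exceptionalHodgeLocus p)ᶜ :=
  dense_compl_of_countable' ψ hcov (h.countable_exceptionalHodgeLocus_of_ends hpk hcov A hcore hcont hinj)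

omit [FiniteDimensional ℚ V] in
/-- Over a punctured compact curve: the exceptional locus is countable with dense complement.
[cite: CattaniDeligneKaplan1995, Thm. 1.1, Cor. 1.2 (p. 484), 2.3 (p. 487)] [cite: VoisinHodgeII2003, §3.3.2 (remark after Thm. 3.32)] -/
theorem countable_and_dense_compl_exceptionalHodgeLocus_of_compactification (h : D.IsLocallyFlatCharted ψ σ) (hpk : p + p = k)
    (hcov : ∀ x : S, ∃ a, x ∈ (ψ a).source) (A : ι → ℝ)
    {j : S → X} (hj : IsEmbedding j) (pt : ι → X) (hpS : ∀ i, pt i ∉ range j) (hcovX : ∀ x : X, x ∉ range j → ∃ i, x = pt i)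
    (φ : ι → OpenPartialHomeomorph X ℂ) (hp : ∀ i, pt i ∈ (φ i).source) (hφp : ∀ i, φ i (pt i) = 0)
    (hball : ∀ i, Metric.ball (0 : ℂ) (Real.exp (-(2 * Real.pi * A i))) ⊆ (φ i).target)
    (hσ : ∀ (i : ι) (z : ℂ), A i < z.im → j (σ i z) = (φ i).symm (Complex.exp (2 * Real.pi * Complex.I * z))) :
    (D.exceptionalHodgeLocus p).Countable ∧ Dense (D.exceptionalHodgeLocus p)ᶜ :=
  ⟨h.countable_exceptionalHodgeLocus_of_ends hpk hcov A (Topology.exists_isCompact_core hj pt hpS hcovX φ hp hφp A hball σ hσ)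
      (continuousOn_end_lifts hj φ A hball σ hσ) (exists_injOn_end_lifts φ A hball σ hσ),
    h.dense_compl_exceptionalHodgeLocus_of_ends hpk hcov A (Topology.exists_isCompact_core hj pt hpS hcovX φ hp hφp A hball σ hσ)
      (continuousOn_end_lifts hj φ A hball σ hσ) (exists_injOn_end_lifts φ A hball σ hσ)⟩

end IsLocallyFlatCharted

/-- **Non-generic ⟹ bounded exceptional** (path-connected base): a class of type `(p,p)` with `Q(u,u) ≤ K` admitting NO determination of type `(p,p)` at
some point has a continuation that is not of type `(p,p)`; so `nonGenericHodgeLocus D p K` lies in the finite set of §3.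
[cite: CattaniDeligneKaplan1995, §1 (p. 484), Thm. 1.1, Cor. 1.3] -/
theorem nonGenericHodgeLocus_subset_setOf_exceptional_le [PathConnectedSpace S] (D : VHSData S k) (p K : ℤ) :
    D.nonGenericHodgeLocus p K ⊆
      {s : S | ∃ u : D.VZ.fiber s, D.IsHodgeAt s p u ∧ (D.form s).form (D.toRat s u) (D.toRat s u) ≤ (K : ℚ) ∧ ¬ D.IsHodgeAlong p u univ} := by
  rintro s ⟨u, hu, hK, hne⟩
  refine ⟨u, hu, hK, fun hall => hne (eq_univ_of_forall fun t => ?_)⟩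
  exact ⟨Path.Homotopic.Quotient.mk (PathConnectedSpace.somePath s t), hall (PathConnectedSpace.somePath s t) fun _ => mem_univ _⟩

end Motives.VHSData

end Literature.AlgebraicGeometry

end
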